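import Summits.AtomisticToContinuum.Crystallization.Theorems.SquareWellLayerCakeStackingFaultSparsityFaultBill

/-!
# Crux `StackingFaultSparsity` (stmt-AtomisticToContinuum-14296) is EQUIVALENT to its one open stub

The checked line `Sketch` (`Cruxes/StackingFaultSparsity/Lines/Sketch.lean`, reshape 6) proves the crux
`StackingFaultSparsity` of the routes `SquareWellLayerCake` / `LaminarSixThreeThree` from registered stubs,
all of which have landed except the X-type input `stub_coarsening` ("faulted-grain coarsening": the
particles with an `(R, ε)`-Barlow-but-not-hcp window and NO `(L, ε')`-Barlow window have density `→ 0`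
along every sequence of Lennard-Jones ground states, for every `L, ε'`).

This file records, unconditionally, that the line is SATURATED: the remaining stub is not a proper
sub-statement of the crux but is equivalent to it.

* `faultBill_coarse` — the sharpest finite-`N` bill: for every `R, ε` there are `C ≥ 0` and `L₂` such
  that for every scale `L ≥ L₂`, `L > 0`, some `ε₀ ∈ (0, ε/2]` makes the following hold for EVERY
  tolerance `ε' ∈ (0, ε₀]`, every `N` and every Lennard-Jones ground state `x` of `N` particles:
  `#{(R,ε)-Barlow ∧ ¬hcp} ≤ #{(R,ε)-Barlow ∧ ¬hcp ∧ no (L,ε')-Barlow window} + C·N/L`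
  (refines `faultBill`, whose first term counts ALL particles without an `(L, ε')`-Barlow window).
* `StackingFaultSparsity_of_frequentCoarsening` — the crux from the weakest form of coarsening the
  composition uses: along each ground-state sequence, for arbitrarily large scales `L` and, at each such
  `L`, arbitrarily small tolerances `ε'`, the faulted particles without an `(L, ε')`-Barlow window have
  density `→ 0`.
* `stackingFaultSparsity_iff_faultedGrainCoarsening` (route `SquareWellLayerCake`) and
  `stackingFaultSparsity_iff_faultedGrainCoarsening'` (route `LaminarSixThreeThree`, the same term):
  **the crux ↔ the registered stub `stub_coarsening`** (the forward direction is monotonicity of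
  `Nat.card`; the backward one is `faultBill_coarse` + the `C/L`-then-`N` limit).

Reading (planner note D-0014 of the line leads): every proof of the crux must supply faulted-grain
coarsening, i.e. exclude a positive density of bounded faulted Barlow grains (e.g. unit cuboctahedral
13-clusters, counted at `(R, ε) = (1, 1/100)` by `Negative/Cuboctahedron.lean`) in a non-Barlow bulk —
the content of the open item stmt-AtomisticToContinuum-14292 (`LaminarBarlowWindows`) on the bad set.
All `[folklore]` glue over the landed files; nothing here closes the item.
-/

noncomputable section

open scoped Topology
open Filter
open Literature.MathematicalPhysics.StatisticalMechanics
open Summit.AtomisticToContinuum.Crystallization.Theorems.SquareWellLayerCake.StackingFaultSparsity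
open Summit.AtomisticToContinuum.Crystallization.Theorems.SquareWellLayerCake.StackingFaultSparsity.OfLaminarBarlowWindows
  (selection_count natCard_le_add tendsto_density_mono)

namespace Summit.AtomisticToContinuum.Crystallization.Theorems.SquareWellLayerCake.StackingFaultSparsity.IffCoarsening

/-- **The coarse fault bill (finite `N`, unconditional, sharpest form).** For every `R > 0`,
`ε ∈ (0, 1/4)` there are `C ≥ 0` and `L₂` such that for every `L ≥ L₂`, `L > 0`, some
`ε₀ ∈ (0, ε/2]` makes the following hold for EVERY `ε' ∈ (0, ε₀]`, every `N` and every Lennard-Jones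
ground state `x`: the number of particles whose `R`-window is `(R, ε)`-matched to some Barlow stacking
but to no hcp stacking is at most the number of SUCH particles without an `(L, ε')`-Barlow window, plus
`C·N/L`. (Split `Bad ⊆ [Bad ∧ ¬BarlowM(L,ε')] ∪ [BarlowM(L,ε') ∧ ¬HcpM(R,ε)]`, bound the second part
by the landed `selection_count` at `ε₀` after `BarlowM.mono` in the tolerance.) [folklore] -/
theorem faultBill_coarse :
    ∀ R ε : ℝ, 0 < R → 0 < ε → ε < 1 / 4 →
    ∃ C : ℝ, 0 ≤ C ∧ ∃ L₂ : ℝ, ∀ L : ℝ, L₂ ≤ L → 0 < L → ∃ ε₀ : ℝ, 0 < ε₀ ∧ ε₀ ≤ ε / 2 ∧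
      ∀ ε' : ℝ, 0 < ε' → ε' ≤ ε₀ →
      ∀ (N : ℕ) (x : Fin N → EuclideanSpace ℝ (Fin 3)), IsGroundState lennardJones x →
        (Nat.card {i : Fin N // BarlowM R ε x i ∧ ¬ HcpM R ε x i} : ℝ) ≤
          Nat.card {i : Fin N // (BarlowM R ε x i ∧ ¬ HcpM R ε x i) ∧ ¬ BarlowM L ε' x i}
            + C * N / L := by
  intro R ε hR hε hε4
  obtain ⟨C, hC0, L₂, hsel⟩ := selection_count R ε hR hε hε4
  refine ⟨C, hC0, L₂, fun L hL hLpos => ?_⟩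
  obtain ⟨ε₀, hε₀pos, hε₀le, hcount⟩ := hsel L hL hLpos
  refine ⟨ε₀, hε₀pos, hε₀le, fun ε' _ hε'le N x hx => ?_⟩
  have hsplit : (Nat.card {i : Fin N // BarlowM R ε x i ∧ ¬ HcpM R ε x i} : ℝ) ≤
      (Nat.card {i : Fin N // (BarlowM R ε x i ∧ ¬ HcpM R ε x i) ∧ ¬ BarlowM L ε' x i} : ℝ)
        + (Nat.card {i : Fin N // BarlowM L ε' x i ∧ ¬ HcpM R ε x i} : ℝ) := by
    exact_mod_cast natCard_le_add (N := N)
      (P := fun i => BarlowM R ε x i ∧ ¬ HcpM R ε x i)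
      (Q₁ := fun i => (BarlowM R ε x i ∧ ¬ HcpM R ε x i) ∧ ¬ BarlowM L ε' x i)
      (Q₂ := fun i => BarlowM L ε' x i ∧ ¬ HcpM R ε x i)
      (fun i hi => by
        by_cases hB : BarlowM L ε' x i
        · exact Or.inr ⟨hB, hi.2⟩
        · exact Or.inl ⟨hi, hB⟩)
  -- a window matched at the finer tolerance `ε'` is matched at `ε₀`
  have hmono : (Nat.card {i : Fin N // BarlowM L ε' x i ∧ ¬ HcpM R ε x i} : ℝ) ≤
      (Nat.card {i : Fin N // BarlowM L ε₀ x i ∧ ¬ HcpM R ε x i} : ℝ) := by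
    exact_mod_cast
      Summit.AtomisticToContinuum.Crystallization.Theorems.BrittleRungDescentRungAssembly.natCard_subtype_le_of_imp
        (p := fun i => BarlowM L ε' x i ∧ ¬ HcpM R ε x i)
        (q := fun i => BarlowM L ε₀ x i ∧ ¬ HcpM R ε x i)
        (fun i hi => ⟨hi.1.mono le_rfl hε'le, hi.2⟩)
  have hc := hcount N x hx
  linarith

/-- **The crux from FREQUENT coarsening** (the weakest form of the X-type input that the composition of
line `Sketch` uses): if along every sequence of Lennard-Jones ground states, for every `R, ε`, there are
arbitrarily large scales `L` at each of which, for arbitrarily small tolerances `ε'`, the particles with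
an `(R, ε)`-Barlow-but-not-hcp window and no `(L, ε')`-Barlow window have density `→ 0`, then
`StackingFaultSparsity` holds. (Given `η`, pick such an `L ≥ max(L₂, 2C/η)`, then such an
`ε' ≤ ε₀(L)`; `faultBill_coarse` gives `limsup ≤ η/2 + C/L ≤ η`.) [folklore] -/
theorem StackingFaultSparsity_of_frequentCoarsening
    (hX : ∀ R ε : ℝ, 0 < R → 0 < ε → ε < 1 / 4 →
      ∀ x : (N : ℕ) → (Fin N → EuclideanSpace ℝ (Fin 3)), (∀ N, IsGroundState lennardJones (x N)) →
      ∀ L₀ : ℝ, ∃ L : ℝ, L₀ ≤ L ∧ ∀ ε₀ : ℝ, 0 < ε₀ → ∃ ε' : ℝ, 0 < ε' ∧ ε' ≤ ε₀ ∧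
        Tendsto (fun N : ℕ =>
          (Nat.card {i : Fin N // (BarlowM R ε (x N) i ∧ ¬ HcpM R ε (x N) i) ∧
            ¬ BarlowM L ε' (x N) i} : ℝ) / N) atTop (𝓝 0)) :
    Summit.AtomisticToContinuum.Crystallization.Theses.SquareWellLayerCake.StackingFaultSparsity := by
  refine stackingFaultSparsity_iff.1 fun R ε hR hε hε4 x hx => ?_
  obtain ⟨C, hC0, L₂, hbill⟩ := faultBill_coarse R ε hR hε hε4
  refine Summit.AtomisticToContinuum.Crystallization.Theorems.certificatesDefectVanish_tendsto_zero
    (fun N => by positivity) fun η hη => ?_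
  -- choose the scale: `L ≥ L₂`, `L ≥ 1`, `C / L ≤ η / 2`
  obtain ⟨L, hL, hLε⟩ := hX R ε hR hε hε4 x hx (max (max L₂ 1) (2 * C / η))
  have hL₂ : L₂ ≤ L := ((le_max_left _ _).trans (le_max_left _ _)).trans hL
  have hL1 : (1 : ℝ) ≤ L := ((le_max_right _ _).trans (le_max_left _ _)).trans hL
  have hLpos : 0 < L := by linarith
  have hCL : C / L ≤ η / 2 := by
    rw [div_le_iff₀ hLpos]
    have : 2 * C / η ≤ L := (le_max_right _ _).trans hL
    rw [div_le_iff₀ hη] at this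
    linarith
  obtain ⟨ε₀, hε₀pos, _, hcount⟩ := hbill L hL₂ hLpos
  -- choose the tolerance: `ε' ≤ ε₀` with the coarse part `→ 0`
  obtain ⟨ε', hε'pos, hε'le, hco⟩ := hLε ε₀ hε₀pos
  have hco' : ∀ᶠ N : ℕ in atTop,
      (Nat.card {i : Fin N // (BarlowM R ε (x N) i ∧ ¬ HcpM R ε (x N) i) ∧ ¬ BarlowM L ε' (x N) i} : ℝ)
        / N ≤ η / 2 :=
    (hco.eventually (Iic_mem_nhds (show (0 : ℝ) < η / 2 by positivity))).mono fun N hN => hN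
  filter_upwards [hco', eventually_gt_atTop 0] with N hN hNpos
  have hNr : (0 : ℝ) < N := by exact_mod_cast hNpos
  have hb := hcount ε' hε'pos hε'le N (x N) (hx N)
  rw [div_le_iff₀ hNr] at hN ⊢
  have h2 : C * N / L = (C / L) * N := by ring
  rw [h2] at hb
  have h3 : (C / L) * N ≤ (η / 2) * N := mul_le_mul_of_nonneg_right hCL hNr.le
  linarith

/-- **The crux from faulted-grain coarsening** (the registered stub `stub_coarsening` of line `Sketch`,
verbatim as hypothesis): coarsening for EVERY `L, ε'` is in particular frequent coarsening. [folklore] -/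
theorem StackingFaultSparsity_of_faultedGrainCoarsening
    (hX : ∀ R ε L ε' : ℝ, 0 < R → 0 < ε → ε < 1 / 4 → 0 < L → 0 < ε' → ε' < 1 / 4 →
      ∀ x : (N : ℕ) → (Fin N → EuclideanSpace ℝ (Fin 3)), (∀ N, IsGroundState lennardJones (x N)) →
        Tendsto (fun N : ℕ =>
          (Nat.card {i : Fin N // (BarlowM R ε (x N) i ∧ ¬ HcpM R ε (x N) i) ∧
            ¬ BarlowM L ε' (x N) i} : ℝ) / N) atTop (𝓝 0)) :
    Summit.AtomisticToContinuum.Crystallization.Theses.SquareWellLayerCake.StackingFaultSparsity := by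
  refine StackingFaultSparsity_of_frequentCoarsening fun R ε hR hε hε4 x hx L₀ => ?_
  refine ⟨max L₀ 1, le_max_left _ _, fun ε₀ hε₀ => ?_⟩
  refine ⟨min ε₀ (1 / 8), lt_min hε₀ (by norm_num), min_le_left _ _, ?_⟩
  exact hX R ε (max L₀ 1) (min ε₀ (1 / 8)) hR hε hε4 (lt_of_lt_of_le one_pos (le_max_right _ _))
    (lt_min hε₀ (by norm_num)) ((min_le_right _ _).trans_lt (by norm_num)) x hx

/-- **Faulted-grain coarsening from the crux** (the trivial direction): the coarse bad set is a subset
of the bad set, so its density `→ 0` whenever the bad set's does. [folklore] -/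
theorem faultedGrainCoarsening_of_StackingFaultSparsity
    (hS : Summit.AtomisticToContinuum.Crystallization.Theses.SquareWellLayerCake.StackingFaultSparsity) :
    ∀ R ε L ε' : ℝ, 0 < R → 0 < ε → ε < 1 / 4 → 0 < L → 0 < ε' → ε' < 1 / 4 →
      ∀ x : (N : ℕ) → (Fin N → EuclideanSpace ℝ (Fin 3)), (∀ N, IsGroundState lennardJones (x N)) →
        Tendsto (fun N : ℕ =>
          (Nat.card {i : Fin N // (BarlowM R ε (x N) i ∧ ¬ HcpM R ε (x N) i) ∧
            ¬ BarlowM L ε' (x N) i} : ℝ) / N) atTop (𝓝 0) := by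
  intro R ε L ε' hR hε hε4 _ _ _ x hx
  exact tendsto_density_mono (fun N i hi => hi.1) (hS R ε hR hε hε4 x hx)

/-- **The crux ↔ its registered stub** (route `SquareWellLayerCake`): `StackingFaultSparsity` holds iff,
for all `R > 0`, `ε ∈ (0, 1/4)`, `L > 0`, `ε' ∈ (0, 1/4)` and every sequence of Lennard-Jones ground
states, the particles with an `(R, ε)`-Barlow-but-not-hcp window and no `(L, ε')`-Barlow window have
density `→ 0` (faulted-grain coarsening, the X-type stub `stub_coarsening` of line `Sketch`).  The line
is saturated: what is left of the crux is the crux. [folklore] -/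
theorem stackingFaultSparsity_iff_faultedGrainCoarsening :
    Summit.AtomisticToContinuum.Crystallization.Theses.SquareWellLayerCake.StackingFaultSparsity ↔
    (∀ R ε L ε' : ℝ, 0 < R → 0 < ε → ε < 1 / 4 → 0 < L → 0 < ε' → ε' < 1 / 4 →
      ∀ x : (N : ℕ) → (Fin N → EuclideanSpace ℝ (Fin 3)), (∀ N, IsGroundState lennardJones (x N)) →
        Tendsto (fun N : ℕ =>
          (Nat.card {i : Fin N // (BarlowM R ε (x N) i ∧ ¬ HcpM R ε (x N) i) ∧
            ¬ BarlowM L ε' (x N) i} : ℝ) / N) atTop (𝓝 0)) :=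
  ⟨faultedGrainCoarsening_of_StackingFaultSparsity, StackingFaultSparsity_of_faultedGrainCoarsening⟩

/-- **The crux ↔ its registered stub**, for the shared item's home route `LaminarSixThreeThree` (the
two route decls are the same term). [folklore] -/
theorem stackingFaultSparsity_iff_faultedGrainCoarsening' :
    Summit.AtomisticToContinuum.Crystallization.Theses.LaminarSixThreeThree.StackingFaultSparsity ↔
    (∀ R ε L ε' : ℝ, 0 < R → 0 < ε → ε < 1 / 4 → 0 < L → 0 < ε' → ε' < 1 / 4 →
      ∀ x : (N : ℕ) → (Fin N → EuclideanSpace ℝ (Fin 3)), (∀ N, IsGroundState lennardJones (x N)) →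
        Tendsto (fun N : ℕ =>
          (Nat.card {i : Fin N // (BarlowM R ε (x N) i ∧ ¬ HcpM R ε (x N) i) ∧
            ¬ BarlowM L ε' (x N) i} : ℝ) / N) atTop (𝓝 0)) :=
  stackingFaultSparsity_iff_faultedGrainCoarsening

/-- **Frequent coarsening already suffices on the home route** `LaminarSixThreeThree` (same term as
`StackingFaultSparsity_of_frequentCoarsening`). [folklore] -/
theorem StackingFaultSparsity_of_frequentCoarsening'
    (hX : ∀ R ε : ℝ, 0 < R → 0 < ε → ε < 1 / 4 →
      ∀ x : (N : ℕ) → (Fin N → EuclideanSpace ℝ (Fin 3)), (∀ N, IsGroundState lennardJones (x N)) →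
      ∀ L₀ : ℝ, ∃ L : ℝ, L₀ ≤ L ∧ ∀ ε₀ : ℝ, 0 < ε₀ → ∃ ε' : ℝ, 0 < ε' ∧ ε' ≤ ε₀ ∧
        Tendsto (fun N : ℕ =>
          (Nat.card {i : Fin N // (BarlowM R ε (x N) i ∧ ¬ HcpM R ε (x N) i) ∧
            ¬ BarlowM L ε' (x N) i} : ℝ) / N) atTop (𝓝 0)) :
    Summit.AtomisticToContinuum.Crystallization.Theses.LaminarSixThreeThree.StackingFaultSparsity :=
  StackingFaultSparsity_of_frequentCoarsening hX

end Summit.AtomisticToContinuum.Crystallization.Theorems.SquareWellLayerCake.StackingFaultSparsity.IffCoarsening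

end
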